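import Summits.Ventures.PercRepro.RankLevelSetBiIndepAbsorbNormSkew

/-! # RankLevelSetBiIndepUpSet — THE UP-SET PROFILES: MONO, (★★) AND (ABS-norm) AS STATEMENTS ABOUT A MATROID AND AN
ARBITRARY FILTER OF ITS FLATS — THE `Prop`s (UP), (IO) AND THE RUNGS (UP) ⟹ MONO, (IO) ON THE DELETIONS ⟹ (ABS-norm)
(night-1 g32; dossier §44.3)

For a matroid `M` and a family `U` of subsets of `E` that is UP-CLOSED AMONG FLATS (`UpSetFlats M U`: a member's
closure-supersets that are flats are members) write `W in` for `M.closure W ∈ U`. The UP-SET PROFILE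
`u_k = #{W ∈ D_k : W in}` (`upCount`) and the IN-OUT PROFILE `a_k = #{W ∈ D_k : W in, E ∖ W out}` (`inOutCount`).
CONJECTURES of record (census: every up-set of every lattice of flats with ≤ 40 flats on ≤ 6 elements, 1.9 M up-sets,
0 failures; n = 7 principal / 2-generated / random, 0 failures; dossier §44.3): **(UP)** `NormSkew (u) #E`,
**(IO)** `NormSkew (a) (#E + 1)`. They are FALSE for families that are not closure-closed (the through-`x` profile of
the 3-page book), so the closure operator is essential, while the modular-cut axiom is not. THE RUNGS, in the kernel:
`U = univ` gives `u = D`, so (UP) ⟹ Mono (**`biIndepMono_of_upNormSkew`**); for `x ∈ E` the family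
`U_x = {F : x ∈ cl_M F}` is up-closed among flats of `M ＼ {x}` and its in-out profile in `M ＼ {x}` is the absorbing
avoid-`x` profile of `M` (**`lowAbsorbCount_eq_inOutCount_delete`**: `W` avoids `x` and is bi-independent in `M` with
`x ∈ cl W` iff `W` is bi-independent in `M ＼ {x}`, `W` spans `x` and `E ∖ ({x} ∪ W)` does not), so (IO) on the
deletions `M ＼ {x}` gives (ABS-norm) of `M` with the right parameter `(#E − 1) + 1` (**`absorbNormSkew_of_inOut`**).
Every declaration has a docstring; imports: the cell's own modules and Mathlib only. Axioms: standard. -/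

namespace PercRepro

open Set Matroid

variable {α : Type} (M : Matroid α) [M.Finite]

/-! ## Up-sets of flats and the two profiles -/

omit [M.Finite] in
/-- **A family of sets up-closed among flats**: if `F ∈ U` and `G` is a flat of `M` containing `F`, then `G ∈ U`. -/
def UpSetFlats (U : Set (Set α)) : Prop := ∀ F ∈ U, ∀ G, M.IsFlat G → F ⊆ G → G ∈ U

/-- **The up-set profile** `u_k = #{W ∈ D_k : cl W ∈ U}`. -/
noncomputable def upCount (U : Set (Set α)) (k : ℕ) : ℕ := {W ∈ biIndep M k | M.closure W ∈ U}.ncard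

/-- **The in-out profile** `a_k = #{W ∈ D_k : cl W ∈ U, cl (E ∖ W) ∉ U}`. -/
noncomputable def inOutCount (U : Set (Set α)) (k : ℕ) : ℕ :=
  {W ∈ biIndep M k | M.closure W ∈ U ∧ M.closure (M.E \ W) ∉ U}.ncard

omit [M.Finite] in
/-- **(UP)** (night-1 g32; a `Prop`, NOT asserted): every up-set profile satisfies the normalized half rule with
parameter `#E`. -/
def BiIndepUpNormSkew : Prop := ∀ U : Set (Set α), UpSetFlats M U → SkewConv.NormSkew (upCount M U) M.E.ncard

omit [M.Finite] in
/-- **(IO)** (night-1 g32; a `Prop`, NOT asserted): every in-out profile satisfies the normalized half rule with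
parameter `#E + 1`. -/
def BiIndepInOutNormSkew : Prop :=
  ∀ U : Set (Set α), UpSetFlats M U → SkewConv.NormSkew (inOutCount M U) (M.E.ncard + 1)

/-! ## (UP) ⟹ Mono -/

omit [M.Finite] in
/-- The family of all sets is up-closed among flats. -/
lemma upSetFlats_univ : UpSetFlats M Set.univ := fun _ _ _ _ _ => Set.mem_univ _

omit [M.Finite] in
/-- The up-set profile of `univ` is the bi-independent profile. -/
lemma upCount_univ (k : ℕ) : upCount M Set.univ k = biIndepCount M k := by
  unfold upCount biIndepCount
  congr 1
  ext W
  simp only [Set.mem_setOf_eq, Set.mem_univ, and_true]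

omit [M.Finite] in
/-- **(UP) ⟹ Mono.** -/
theorem biIndepMono_of_upNormSkew (h : BiIndepUpNormSkew M) : BiIndepMono M := by
  apply biIndepMono_of_normSkew
  exact SkewConv.normSkew_congr (h Set.univ (upSetFlats_univ M)) fun k _ => upCount_univ M k

/-! ## (IO) on the deletions ⟹ (ABS-norm) -/

omit [M.Finite] in
/-- **The cut of `x`**: the sets whose `M`-closure contains `x`; up-closed among flats of `M ＼ {x}` (and of `M`). -/
def cutOf (x : α) : Set (Set α) := {F : Set α | x ∈ M.closure F}

omit [M.Finite] in
/-- `cutOf x` is up-closed among the flats of the deletion `M ＼ {x}`. -/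
lemma upSetFlats_cutOf_delete (x : α) : UpSetFlats (M.delete {x}) (cutOf M x) := by
  intro F hF G _ hFG
  exact M.closure_subset_closure hFG hF

omit [M.Finite] in
/-- Spanning `x` is a property of the `(M ＼ {x})`-closure: `x ∈ cl_M (cl_{M ＼ x} W) ↔ x ∈ cl_M W` for `W ⊆ E ∖ {x}`. -/
lemma mem_closure_delete_closure_iff {x : α} {W : Set α} (hWE : W ⊆ M.E) (hW : x ∉ W) :
    x ∈ M.closure ((M.delete {x}).closure W) ↔ x ∈ M.closure W := by
  rw [Matroid.delete_closure_eq, Set.sdiff_singleton_eq_self hW]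
  constructor
  · intro h
    have : M.closure (M.closure W \ {x}) ⊆ M.closure W :=
      M.closure_subset_closure_of_subset_closure (Set.sdiff_subset.trans (Set.Subset.refl _))
    exact this h
  · intro h
    have hsub : W ⊆ M.closure W \ {x} := fun y hy => ⟨M.subset_closure W hWE hy, fun hyx =>
      hW (Set.mem_singleton_iff.mp hyx ▸ hy)⟩
    exact M.closure_subset_closure hsub h

omit [M.Finite] in
/-- **The absorbing avoid-`x` profile of `M` is the in-out profile of the cut of `x` in `M ＼ {x}`.** -/
theorem lowAbsorbCount_eq_inOutCount_delete {x : α} (hx : x ∈ M.E) (k : ℕ) :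
    lowAbsorbCount M x k = inOutCount (M.delete {x}) (cutOf M x) k := by
  unfold lowAbsorbCount inOutCount
  congr 1
  ext W
  simp only [lowAbsorbAt, biIndep, Set.mem_setOf_eq, cutOf, Matroid.delete_ground, Matroid.delete_indep_iff,
    Set.disjoint_singleton_right]
  constructor
  · rintro ⟨⟨hWE, hk, hWind, hcind⟩, hxW, hdep⟩
    have hcompl : (M.E \ {x}) \ W = (M.E \ W) \ {x} := by
      ext y; simp only [Set.mem_sdiff, Set.mem_singleton_iff]; tauto
    have hxc : x ∉ (M.E \ W) \ {x} := fun h => h.2 rfl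
    have hEW : insert x ((M.E \ W) \ {x}) = M.E \ W := Set.insert_sdiff_self_of_mem ⟨hx, hxW⟩
    refine ⟨⟨fun y hy => ⟨hWE hy, fun hyx => hxW (Set.mem_singleton_iff.mp hyx ▸ hy)⟩, hk, ⟨hWind, hxW⟩, ?_⟩, ?_, ?_⟩
    · rw [hcompl]; exact ⟨hcind.subset Set.sdiff_subset, hxc⟩
    · rw [mem_closure_delete_closure_iff M hWE hxW]
      by_contra hcl
      exact hdep ((hWind.insert_indep_iff_of_notMem hxW).mpr ⟨hx, hcl⟩)
    · rw [hcompl, mem_closure_delete_closure_iff M (Set.sdiff_subset.trans Set.sdiff_subset) hxc]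
      intro hcl
      have hind : M.Indep (insert x ((M.E \ W) \ {x})) := by rw [hEW]; exact hcind
      exact ((hcind.subset Set.sdiff_subset).insert_indep_iff_of_notMem hxc).mp hind |>.2 hcl
  · rintro ⟨⟨hWE, hk, ⟨hWind, hxW⟩, hcind, hxc'⟩, hin, hout⟩
    have hcompl : (M.E \ {x}) \ W = (M.E \ W) \ {x} := by
      ext y; simp only [Set.mem_sdiff, Set.mem_singleton_iff]; tauto
    rw [hcompl] at hcind hout
    have hxc : x ∉ (M.E \ W) \ {x} := fun h => h.2 rfl
    rw [mem_closure_delete_closure_iff M (Set.sdiff_subset.trans Set.sdiff_subset) hxc] at hout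
    rw [mem_closure_delete_closure_iff M (fun y hy => (hWE hy).1) hxW] at hin
    have hEW : insert x ((M.E \ W) \ {x}) = M.E \ W := Set.insert_sdiff_self_of_mem ⟨hx, hxW⟩
    refine ⟨⟨fun y hy => (hWE hy).1, hk, hWind, ?_⟩, hxW, ?_⟩
    · rw [← hEW]
      exact (hcind.insert_indep_iff_of_notMem hxc).mpr ⟨hx, hout⟩
    · intro hind
      exact ((hWind.insert_indep_iff_of_notMem hxW).mp hind).2 hin

/-- **(IO) ON THE DELETIONS ⟹ (ABS-norm)**: the in-out profile of the cut of `x` in `M ＼ {x}` (on `#E − 1`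
elements, parameter `(#E − 1) + 1 = #E`) is the absorbing avoid-`x` profile of `M`. -/
theorem absorbNormSkew_of_inOut (h : ∀ x ∈ M.E, BiIndepInOutNormSkew (M.delete {x})) :
    BiIndepAbsorbNormSkew M := by
  intro x hx
  haveI : (M.delete {x}).Finite := ⟨M.ground_finite.subset (by rw [Matroid.delete_ground]; exact Set.sdiff_subset)⟩
  have hcard : (M.delete {x}).E.ncard + 1 = M.E.ncard := by
    rw [Matroid.delete_ground, Set.ncard_sdiff_singleton_of_mem hx]
    exact Nat.sub_add_cancel (Set.ncard_pos M.ground_finite |>.mpr ⟨x, hx⟩)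
  have hIO := h x hx (cutOf M x) (upSetFlats_cutOf_delete M x)
  rw [hcard] at hIO
  exact SkewConv.normSkew_congr hIO fun k _ => (lowAbsorbCount_eq_inOutCount_delete M hx k).symm

end PercRepro
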